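import Mathlib.NumberTheory.NumberField.Basic
import Mathlib.NumberTheory.NumberField.Discriminant.Basic
import Mathlib.NumberTheory.NumberField.Ideal.KummerDedekind
import Mathlib.RingTheory.Discriminant
import Mathlib.RingTheory.Polynomial.Eisenstein.IsIntegral
import Mathlib.RingTheory.Adjoin.PowerBasis
import Mathlib.FieldTheory.Minpoly.IsIntegrallyClosed
import Mathlib.Algebra.Polynomial.SpecificDegree
import Mathlib.Algebra.Polynomial.Eval.Irreducible
import Mathlib.FieldTheory.Galois.Basic
import Mathlib.NumberTheory.NumberField.Units.DirichletTheorem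
import Mathlib.Topology.Algebra.Polynomial
import Mathlib.Analysis.SpecialFunctions.Pow.Real
import Mathlib.Data.Sign.Basic
import Mathlib.Tactic.NormNum.Prime
import HarnessLib

/-!
# The cyclic cubic field of conductor `1339` in which `2` is inert: `K = ℚ(θ)`, `θ³ + θ² - 446θ - 3769 = 0`

Explicit arithmetic of the cubic field `K''` generated by a root of `f'' = X³ + X² - 446X - 3769`, one
of the two cyclic cubic fields of conductor `1339 = 13 · 103` (the one in which `2` is inert), the
fourth of the four cubic subfields of the field `F₃ = K₁₃ K₁₀₃` of T. Dokchitser–V. Dokchitser,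
*A note on the Mordell–Weil rank modulo `n`* (2011), proof of Thm. 2 (tree:
`RankNotSumOfLocalInvariantsF3CubicPolys.lean`, `theta1339b`). The plan is that of
`CyclicCubicField13.lean` / `CyclicCubicField103.lean`; everything is proved:

* `K = ℚ[X]/(f'')`, `f''` irreducible (mod `2`); the norm and trace forms on `1, θ, θ²`;
  `disc(1, θ, θ²) = 1792921 = 1339² = 13² · 103²`;
* **`𝓞 K = ℤ[θ]`** (`mem_adjoin_θ`, `exists_int_coords`): `1339² z ∈ ℤ[θ]` for `z ∈ 𝓞 K`
  (`Algebra.discr_mul_isIntegral_mem_adjoin`), and the factors `13²`, `103²` are removed by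
  Eisenstein's criterion for `f''(X + 4) = X³ + 13X² - 390X - 5473` at `13` and for
  `f''(X + 34) = X³ + 103X² + 3090X + 21527` at `103` (both primes are totally ramified);
  `exponent_θint = 1` (Dedekind–Kummer applies at every prime);
* the units `u₁ = θ + 12`, `u₂ = -(θ + 13)` of norm `1` (`f'' = (X+12)(X²-11X-314) - 1
  = (X+13)(X²-12X-290) + 1`);
* `Gal(K/ℚ) = ⟨σ⟩ ≅ C₃`, `σθ = θ² - 12θ - 302`, `σ²θ = -θ² + 11θ + 301`; `K/ℚ` is Galois;
  `N(x) = x σx σ²x`;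
* the three real embeddings (roots in `(-14,-13)`, `(-13,-12)`, `(24,25)`), the sign vectors
  `sgn(-1) = (-,-,-)`, `sgn u₁ = (-,-,+)`, `sgn u₂ = (+,-,-)` — a basis of `{±1}³` — hence
  (Dirichlet) **`(𝓞 K)ˣ/(𝓞 K)ˣ² = {±u₁^i u₂^j}`** and totally positive units are squares.

## References

* T. Dokchitser, V. Dokchitser, *A note on the Mordell–Weil rank modulo `n`*, J. Number Theory
  131 (2011) 1833–1839: proof of Thm. 2. [DokchitserDokchitser2011RankModN]
* D. A. Marcus, *Number Fields*, 2nd ed. (2018), Ch. 2 (integral bases, discriminants), Ch. 5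
  (Dirichlet). [Marcus2018]
-/

noncomputable section

open Polynomial NumberField Algebra

namespace Literature.NumberTheory.NumberFields

namespace CyclicCubic1339B

/-! ### The polynomial `f = X³ + X² - 446X - 3769` -/

/-- `f = X³ + X² - 446X - 3769 ∈ ℤ[X]` (`f''` of the tree's `RankNotSumOfLocalInvariantsF3CubicPolys`).
[folklore] -/
abbrev cubicPoly : ℤ[X] := X ^ 3 + X ^ 2 - C 446 * X - C 3769

/-- `f ∈ ℚ[X]`. [folklore] -/
abbrev cubicPolyRat : ℚ[X] := cubicPoly.map (algebraMap ℤ ℚ)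

/-- `cubicPolyRat = X³ + X² - 446X - 3769`. [folklore] -/
theorem cubicPolyRat_eq : cubicPolyRat = X ^ 3 + X ^ 2 - C 446 * X - C 3769 := by
  rw [cubicPolyRat, cubicPoly, Polynomial.map_sub, Polynomial.map_sub, Polynomial.map_add,
    Polynomial.map_pow, Polynomial.map_pow, map_X, Polynomial.map_mul, Polynomial.map_C,
    Polynomial.map_C, map_X]
  norm_num

/-- `f` is monic. [folklore] -/
theorem cubicPoly_monic : cubicPoly.Monic := by
  unfold cubicPoly
  monicity!

/-- `deg f = 3`. [folklore] -/
theorem cubicPoly_natDegree : cubicPoly.natDegree = 3 := by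
  unfold cubicPoly
  compute_degree!

/-- `f mod 2 = X³ + X² + 1` has no root in `𝔽₂`, hence is irreducible. [folklore] -/
theorem irreducible_map_zmod_two : Irreducible (cubicPoly.map (Int.castRingHom (ZMod 2))) := by
  refine irreducible_of_degree_le_three_of_not_isRoot ?_ fun x => ?_
  · rw [cubicPoly_monic.natDegree_map, cubicPoly_natDegree]
    decide
  · fin_cases x <;>
      simp only [cubicPoly, Polynomial.map_add, Polynomial.map_sub, Polynomial.map_pow, map_X,
        Polynomial.map_mul, Polynomial.map_C, IsRoot.def, eval_add, eval_sub, eval_mul, eval_pow,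
        eval_X, eval_C] <;>
      decide

/-- `f` is irreducible over `ℤ`. [folklore] -/
theorem cubicPoly_irreducible : Irreducible cubicPoly :=
  cubicPoly_monic.irreducible_of_irreducible_map _ _ irreducible_map_zmod_two

/-- `f` is irreducible over `ℚ` (Gauss). [folklore] -/
theorem cubicPolyRat_irreducible : Irreducible cubicPolyRat :=
  cubicPoly_monic.irreducible_iff_irreducible_map_fraction_map.mp cubicPoly_irreducible

/-- Irreducibility as a `Fact` (so that `AdjoinRoot cubicPolyRat` is a field). [folklore] -/
instance : Fact (Irreducible cubicPolyRat) := ⟨cubicPolyRat_irreducible⟩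

/-- `f ≠ 0` in `ℚ[X]`. [folklore] -/
theorem cubicPolyRat_ne_zero : cubicPolyRat ≠ 0 := cubicPolyRat_irreducible.ne_zero

/-- `cubicPolyRat` is monic. [folklore] -/
theorem cubicPolyRat_monic : cubicPolyRat.Monic := cubicPoly_monic.map _

/-- `deg cubicPolyRat = 3`. [folklore] -/
theorem cubicPolyRat_natDegree : cubicPolyRat.natDegree = 3 := by
  show (cubicPoly.map (algebraMap ℤ ℚ)).natDegree = 3
  rw [cubicPoly_monic.natDegree_map, cubicPoly_natDegree]

/-! ### The field `K = ℚ[X]/(f)` and its generator `θ` -/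

/-- **The cyclic cubic field `K''` of conductor `1339`**, `K = ℚ[X]/(X³ + X² - 446X - 3769)`. [folklore] -/
abbrev K : Type := AdjoinRoot cubicPolyRat

/-- `K` is a number field. [folklore] -/
instance : NumberField K := by unfold K; infer_instance

/-- `θ ∈ K`, the class of `X`. [folklore] -/
def θ : K := AdjoinRoot.root cubicPolyRat

/-- The cubic relation `θ³ = -θ² + 446θ + 3769`. [folklore] -/
theorem θ_pow_three : θ ^ 3 = -θ ^ 2 + 446 * θ + 3769 := by
  have h : eval₂ (AdjoinRoot.of cubicPolyRat) (AdjoinRoot.root cubicPolyRat) cubicPolyRat = 0 :=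
    AdjoinRoot.eval₂_root cubicPolyRat
  rw [eval₂_map, cubicPoly, eval₂_sub, eval₂_sub, eval₂_add, eval₂_X_pow, eval₂_X_pow, eval₂_mul,
    eval₂_C, eval₂_X, eval₂_C, map_ofNat, map_ofNat] at h
  change θ ^ 3 + θ ^ 2 - 446 * θ - 3769 = 0 at h
  linear_combination h

/-- `θ⁴ = 447θ² + 3323θ - 3769`. [folklore] -/
theorem θ_pow_four : θ ^ 4 = 447 * θ ^ 2 + 3323 * θ - 3769 := by
  have h3 := θ_pow_three
  calc θ ^ 4 = θ * θ ^ 3 := by ring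
    _ = _ := by rw [h3]; ring_nf; rw [h3]; ring

/-- `θ⁵ = 2876θ² + 195593θ + 1684743`. [folklore] -/
theorem θ_pow_five : θ ^ 5 = 2876 * θ ^ 2 + 195593 * θ + 1684743 := by
  calc θ ^ 5 = θ * θ ^ 4 := by ring
    _ = _ := by rw [θ_pow_four]; ring_nf; rw [θ_pow_three]; ring

/-- `θ⁶ = 192717θ² + 2967439θ + 10839644`. [folklore] -/
theorem θ_pow_six : θ ^ 6 = 192717 * θ ^ 2 + 2967439 * θ + 10839644 := by
  calc θ ^ 6 = θ * θ ^ 5 := by ring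
    _ = _ := by rw [θ_pow_five]; ring_nf; rw [θ_pow_three]; ring

/-- `θ` is a root of `f ∈ ℤ[X]`. [folklore] -/
theorem aeval_θ_cubicPoly : aeval θ cubicPoly = 0 := by
  rw [cubicPoly, map_sub, map_sub, map_add, map_pow, map_pow, map_mul, aeval_C, aeval_X, aeval_C,
    map_ofNat, map_ofNat, θ_pow_three]
  ring

/-- `θ` is a root of `f ∈ ℚ[X]`. [folklore] -/
theorem aeval_θ : aeval θ cubicPolyRat = 0 :=
  (aeval_map_algebraMap ℚ θ cubicPoly).trans aeval_θ_cubicPoly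

/-- `θ` is an algebraic integer. [folklore] -/
theorem isIntegral_θ : IsIntegral ℤ θ := ⟨cubicPoly, cubicPoly_monic, aeval_θ_cubicPoly⟩

/-- `minpoly_ℤ θ = f`. [folklore] -/
theorem minpoly_int_θ : minpoly ℤ θ = cubicPoly :=
  (eq_of_monic_of_associated (minpoly.monic isIntegral_θ) cubicPoly_monic
    ((minpoly.irreducible isIntegral_θ).associated_of_dvd cubicPoly_irreducible
      (minpoly.isIntegrallyClosed_dvd isIntegral_θ aeval_θ_cubicPoly)))

/-- `minpoly_ℚ θ = f`. [folklore] -/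
theorem minpoly_rat_θ : minpoly ℚ θ = X ^ 3 + X ^ 2 - C 446 * X - C 3769 := by
  rw [minpoly.isIntegrallyClosed_eq_field_fractions' ℚ isIntegral_θ, minpoly_int_θ]
  exact cubicPolyRat_eq

/-- The power basis `1, θ, θ²` of `K/ℚ`. [folklore] -/
def pbθ : PowerBasis ℚ K := AdjoinRoot.powerBasis cubicPolyRat_ne_zero

/-- The generator of `pbθ` is `θ`. [folklore] -/
theorem pbθ_gen : pbθ.gen = θ := AdjoinRoot.powerBasis_gen _

/-- `pbθ` has dimension `3`. [folklore] -/
theorem pbθ_dim : pbθ.dim = 3 := by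
  rw [pbθ, AdjoinRoot.powerBasis_dim, cubicPolyRat_natDegree]

/-- `[K : ℚ] = 3`. [folklore] -/
theorem finrank_K : Module.finrank ℚ K = 3 := by
  rw [← pbθ_dim, PowerBasis.finrank]

/-- `N_{K/ℚ}(θ) = 3769` (`= (-1)³ f(0)`). [folklore] -/
theorem norm_θ : Algebra.norm ℚ θ = 3769 := by
  have h := PowerBasis.norm_gen_eq_coeff_zero_minpoly pbθ
  rw [pbθ_gen, pbθ_dim, minpoly_rat_θ] at h
  rw [h]
  norm_num [coeff_X_pow, coeff_C, coeff_X]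

/-! ### Norms and traces of explicit elements: the matrix of multiplication on `1, θ, θ²` -/

/-- `deg_ℚ f = 3` as a `degree`. [folklore] -/
theorem cubicPolyRat_degree : cubicPolyRat.degree = 3 := by
  rw [degree_eq_natDegree cubicPolyRat_ne_zero, cubicPolyRat_natDegree]; rfl

/-- The power basis `1, θ, θ²` in Mathlib's `powerBasis'` form. [folklore] -/
abbrev pbX : PowerBasis ℚ K := AdjoinRoot.powerBasis' cubicPolyRat_monic

/-- `pbX` has dimension `3`. [folklore] -/
theorem pbX_dim : pbX.dim = 3 := cubicPolyRat_natDegree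

/-- Coordinates in `pbX`: the class of `p` has as coordinates the coefficients of `p mod f`.
[folklore] -/
theorem repr_mk (p : ℚ[X]) (i : Fin pbX.dim) :
    pbX.basis.repr (AdjoinRoot.mk cubicPolyRat p) i = (p %ₘ cubicPolyRat).coeff i := by
  change (AdjoinRoot.powerBasisAux' cubicPolyRat_monic).repr _ i = _
  rw [AdjoinRoot.powerBasisAux'_repr_apply_to_fun, AdjoinRoot.modByMonicHom_mk]

/-- Entries of the matrix of multiplication by the class of `p` on `1, θ, θ²`. [folklore] -/
theorem leftMulMatrix_mk (p : ℚ[X]) (i j : Fin pbX.dim) :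
    Algebra.leftMulMatrix pbX.basis (AdjoinRoot.mk cubicPolyRat p) i j =
      ((p * X ^ (j : ℕ)) %ₘ cubicPolyRat).coeff i := by
  rw [Algebra.leftMulMatrix_eq_repr_mul, PowerBasis.basis_eq_pow,
    show pbX.gen = AdjoinRoot.mk cubicPolyRat X from (AdjoinRoot.mk_X).symm, ← map_pow, ← map_mul,
    repr_mk]

/-- Reduction of a polynomial modulo `f` to an explicit quadratic remainder, certified by the
quotient `k`. [folklore] -/
theorem modByMonic_cubicPolyRat_eq {q : ℚ[X]} (a b c : ℚ) (k : ℚ[X])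
    (h : q - (C a * X ^ 2 + C b * X + C c) = cubicPolyRat * k) :
    q %ₘ cubicPolyRat = C a * X ^ 2 + C b * X + C c := by
  rw [modByMonic_eq_of_dvd_sub cubicPolyRat_monic (Dvd.intro _ h.symm),
    modByMonic_eq_self_iff cubicPolyRat_monic, cubicPolyRat_degree]
  exact degree_quadratic_le.trans_lt (by decide)

/-- The three remainders `p, pX, pX² (mod f)` for `p = aX² + bX + c` (using
`θ³ = -θ² + 446θ + 3769`, `θ⁴ = 447θ² + 3323θ - 3769`). [folklore] -/
theorem remainders (a b c : ℚ) :
    (C a * X ^ 2 + C b * X + C c) %ₘ cubicPolyRat = C a * X ^ 2 + C b * X + C c ∧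
    ((C a * X ^ 2 + C b * X + C c) * X) %ₘ cubicPolyRat =
      C (b - a) * X ^ 2 + C (446 * a + c) * X + C (3769 * a) ∧
    ((C a * X ^ 2 + C b * X + C c) * X ^ 2) %ₘ cubicPolyRat =
      C (447 * a - b + c) * X ^ 2 + C (3323 * a + 446 * b) * X + C (-3769 * a + 3769 * b) := by
  have h446 : (C 446 : ℚ[X]) = 446 := map_ofNat C 446
  have h3769 : (C 3769 : ℚ[X]) = 3769 := map_ofNat C 3769
  have h447 : (C 447 : ℚ[X]) = 447 := map_ofNat C 447
  have h3323 : (C 3323 : ℚ[X]) = 3323 := map_ofNat C 3323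
  refine ⟨modByMonic_cubicPolyRat_eq a b c 0 (by ring), ?_, ?_⟩
  · exact modByMonic_cubicPolyRat_eq _ _ _ (C a) (by
      rw [cubicPolyRat_eq]; simp only [C_sub, C_add, C_mul, h446, h3769]; ring)
  · exact modByMonic_cubicPolyRat_eq _ _ _ (C a * X + C (b - a)) (by
      rw [cubicPolyRat_eq]; simp only [C_sub, C_add, C_mul, C_neg, h446, h3769, h447, h3323]; ring)

/-- The entries of the multiplication matrix on the reindexed basis. [folklore] -/
theorem leftMulMatrix_reindex (p : ℚ[X]) (i j : Fin 3) :
    Algebra.leftMulMatrix (pbX.basis.reindex (finCongr pbX_dim)) (AdjoinRoot.mk cubicPolyRat p) i j =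
      ((p * X ^ (j : ℕ)) %ₘ cubicPolyRat).coeff (i : ℕ) := by
  have hv : ∀ j : Fin 3, (((finCongr pbX_dim).symm j : Fin pbX.dim) : ℕ) = (j : ℕ) := fun j => rfl
  rw [Algebra.leftMulMatrix_eq_repr_mul, Module.Basis.reindex_apply,
    Module.Basis.repr_reindex_apply, ← Algebra.leftMulMatrix_eq_repr_mul, leftMulMatrix_mk, hv, hv]

/-- **`N(aθ² + bθ + c)` as the determinant of the multiplication matrix** on `1, θ, θ²`, whose
columns are `(c, b, a)`, `(3769a, 446a + c, b - a)`, `(-3769a + 3769b, 3323a + 446b, 447a - b + c)`.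
[folklore] -/
theorem norm_mk_eq (a b c : ℚ) :
    Algebra.norm ℚ (AdjoinRoot.mk cubicPolyRat (C a * X ^ 2 + C b * X + C c)) =
      c * ((446 * a + c) * (447 * a - b + c) - (3323 * a + 446 * b) * (b - a))
        - 3769 * a * (b * (447 * a - b + c) - (3323 * a + 446 * b) * a)
        + (-3769 * a + 3769 * b) * (b * (b - a) - (446 * a + c) * a) := by
  classical
  set p : ℚ[X] := C a * X ^ 2 + C b * X + C c with hp
  have r0 : p %ₘ cubicPolyRat = C a * X ^ 2 + C b * X + C c := (remainders a b c).1
  have r1 : (p * X) %ₘ cubicPolyRat = C (b - a) * X ^ 2 + C (446 * a + c) * X + C (3769 * a) :=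
    (remainders a b c).2.1
  have r2 : (p * X ^ 2) %ₘ cubicPolyRat =
      C (447 * a - b + c) * X ^ 2 + C (3323 * a + 446 * b) * X + C (-3769 * a + 3769 * b) :=
    (remainders a b c).2.2
  have hdet := Algebra.norm_eq_matrix_det (pbX.basis.reindex (finCongr pbX_dim))
    (AdjoinRoot.mk cubicPolyRat p)
  rw [Matrix.det_fin_three] at hdet
  simp only [leftMulMatrix_reindex, Fin.val_zero, Fin.val_one, Fin.val_two, pow_zero, mul_one,
    pow_one, r0, r1, r2, coeff_add, coeff_C_mul, coeff_X_pow, coeff_X, coeff_C] at hdet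
  norm_num at hdet
  rw [hdet]
  ring

/-- **`Tr(aθ² + bθ + c) = 893a - b + 3c`** (trace of the multiplication matrix). [folklore] -/
theorem trace_mk_eq (a b c : ℚ) :
    Algebra.trace ℚ K (AdjoinRoot.mk cubicPolyRat (C a * X ^ 2 + C b * X + C c)) =
      893 * a - b + 3 * c := by
  classical
  set p : ℚ[X] := C a * X ^ 2 + C b * X + C c with hp
  have r0 : p %ₘ cubicPolyRat = C a * X ^ 2 + C b * X + C c := (remainders a b c).1
  have r1 : (p * X) %ₘ cubicPolyRat = C (b - a) * X ^ 2 + C (446 * a + c) * X + C (3769 * a) :=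
    (remainders a b c).2.1
  have r2 : (p * X ^ 2) %ₘ cubicPolyRat =
      C (447 * a - b + c) * X ^ 2 + C (3323 * a + 446 * b) * X + C (-3769 * a + 3769 * b) :=
    (remainders a b c).2.2
  have htr := Algebra.trace_eq_matrix_trace (pbX.basis.reindex (finCongr pbX_dim))
    (AdjoinRoot.mk cubicPolyRat p)
  rw [Matrix.trace_fin_three] at htr
  simp only [leftMulMatrix_reindex, Fin.val_zero, Fin.val_one, Fin.val_two, pow_zero, mul_one,
    pow_one, r0, r1, r2, coeff_add, coeff_C_mul, coeff_X_pow, coeff_X, coeff_C] at htr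
  norm_num at htr
  rw [htr]
  ring

/-- The class of `aX² + bX + c` is `aθ² + bθ + c`. [folklore] -/
theorem mk_quadratic (a b c : ℚ) :
    AdjoinRoot.mk cubicPolyRat (C a * X ^ 2 + C b * X + C c) = (a : K) * θ ^ 2 + (b : K) * θ + c := by
  rw [map_add, map_add, map_mul, map_mul, map_pow, AdjoinRoot.mk_C, AdjoinRoot.mk_C,
    AdjoinRoot.mk_C, AdjoinRoot.mk_X, eq_ratCast, eq_ratCast, eq_ratCast]
  rfl

/-- **The norm form of `K` on `1, θ, θ²`.** [folklore] -/
theorem norm_quadratic (a b c : ℚ) :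
    Algebra.norm ℚ ((a : K) * θ ^ 2 + (b : K) * θ + c) =
      c * ((446 * a + c) * (447 * a - b + c) - (3323 * a + 446 * b) * (b - a))
        - 3769 * a * (b * (447 * a - b + c) - (3323 * a + 446 * b) * a)
        + (-3769 * a + 3769 * b) * (b * (b - a) - (446 * a + c) * a) := by
  rw [← mk_quadratic, norm_mk_eq]

/-- **The trace form of `K` on `1, θ, θ²`**: `Tr(aθ² + bθ + c) = 893a - b + 3c`. [folklore] -/
theorem trace_quadratic (a b c : ℚ) :
    Algebra.trace ℚ K ((a : K) * θ ^ 2 + (b : K) * θ + c) = 893 * a - b + 3 * c := by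
  rw [← mk_quadratic, trace_mk_eq]

/-- `f'(θ) = 3θ² + 2θ - 446`. [folklore] -/
theorem aeval_derivative_minpoly :
    aeval θ (derivative (minpoly ℚ θ)) = ((3 : ℚ) : K) * θ ^ 2 + ((2 : ℚ) : K) * θ + ((-446 : ℚ) : K) := by
  rw [minpoly_rat_θ]
  simp only [map_add, map_sub, derivative_X_pow, derivative_mul, derivative_C, derivative_X,
    zero_mul, zero_add, mul_one, map_mul, map_pow, aeval_X, aeval_C, eq_ratCast,
    Rat.cast_ofNat, Rat.cast_neg, Nat.cast_ofNat, sub_zero]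
  ring

/-- `N(f'(θ)) = -1792921`. [folklore] -/
theorem norm_aeval_derivative : Algebra.norm ℚ (aeval θ (derivative (minpoly ℚ θ))) = -1792921 := by
  rw [aeval_derivative_minpoly, norm_quadratic]
  norm_num

/-- **`disc(1, θ, θ²) = 1792921 = 1339²`** (the discriminant of `X³ + X² - 446X - 3769`).
[folklore] -/
theorem discr_pbθ : Algebra.discr ℚ pbθ.basis = 1792921 := by
  rw [Algebra.discr_powerBasis_eq_norm, finrank_K, pbθ_gen, norm_aeval_derivative]
  norm_num

/-- A non-zero polynomial of degree `≤ 2` does not vanish at `θ`. [folklore] -/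
theorem quadratic_ne_zero {a b c : ℚ} (h : (a, b, c) ≠ (0, 0, 0)) :
    (a : K) * θ ^ 2 + (b : K) * θ + c ≠ 0 := by
  rw [← mk_quadratic, Ne, AdjoinRoot.mk_eq_zero]
  intro hdvd
  have hq0 : (C a * X ^ 2 + C b * X + C c : ℚ[X]) ≠ 0 := by
    intro h0
    apply h
    have ha : a = 0 := by simpa using congrArg (coeff · 2) h0
    have hb : b = 0 := by simpa [ha] using congrArg (coeff · 1) h0
    have hc : c = 0 := by simpa [ha, hb] using congrArg (coeff · 0) h0
    rw [ha, hb, hc]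
  have hdeg := degree_le_of_dvd hdvd hq0
  rw [cubicPolyRat_degree] at hdeg
  exact absurd (hdeg.trans degree_quadratic_le) (by decide)

/-! ### `𝓞 K = ℤ[θ]`: Eisenstein at the totally ramified primes `13` and `103` -/

/-- `θ` (as the generator of `pbθ`) is integral. [folklore] -/
theorem isIntegral_pbθ_gen : IsIntegral ℤ pbθ.gen := by rw [pbθ_gen]; exact isIntegral_θ

/-- `θ - c` is integral over `ℚ`. [folklore] -/
theorem isIntegral_rat_θ_sub (c : ℕ) : IsIntegral ℚ (θ - c : K) := Algebra.IsIntegral.isIntegral _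

/-- `ℚ(θ - c) = K`. [folklore] -/
theorem adjoin_rat_θ_sub_eq_top (c : ℕ) : Algebra.adjoin ℚ ({θ - c} : Set K) = ⊤ := by
  refine PowerBasis.adjoin_eq_top_of_gen_mem_adjoin (B := pbθ) ?_
  have hmem : (θ - c : K) + algebraMap ℚ K c ∈ Algebra.adjoin ℚ ({θ - c} : Set K) :=
    Subalgebra.add_mem _ (Algebra.self_mem_adjoin_singleton ℚ _) (Subalgebra.algebraMap_mem _ _)
  have h : (θ - c : K) + algebraMap ℚ K c = θ := by rw [map_natCast]; ring
  rw [h] at hmem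
  rw [pbθ_gen]
  exact hmem

/-- The power basis of `K/ℚ` generated by `θ - c`. [folklore] -/
def pbShift (c : ℕ) : PowerBasis ℚ K := PowerBasis.ofAdjoinEqTop (isIntegral_rat_θ_sub c) (adjoin_rat_θ_sub_eq_top c)

/-- The generator of `pbShift c` is `θ - c`. [folklore] -/
theorem pbShift_gen (c : ℕ) : (pbShift c).gen = θ - c := PowerBasis.ofAdjoinEqTop_gen _ _

/-- `θ - c` is an algebraic integer. [folklore] -/
theorem isIntegral_θ_sub (c : ℕ) : IsIntegral ℤ (θ - c : K) := by
  have h : IsIntegral ℤ ((c : ℤ) : K) := isIntegral_algebraMap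
  rw [Int.cast_natCast] at h
  exact isIntegral_θ.sub h

/-- `ℤ[θ - c] = ℤ[θ]`. [folklore] -/
theorem adjoin_θ_sub_eq (c : ℕ) : Algebra.adjoin ℤ ({θ - c} : Set K) = Algebra.adjoin ℤ ({θ} : Set K) := by
  apply le_antisymm
  · refine Algebra.adjoin_le (Set.singleton_subset_iff.mpr ?_)
    exact Subalgebra.sub_mem _ (Algebra.self_mem_adjoin_singleton ℤ _) (Subalgebra.natCast_mem _ c)
  · refine Algebra.adjoin_le (Set.singleton_subset_iff.mpr ?_)
    have hmem : (θ - c : K) + c ∈ Algebra.adjoin ℤ ({θ - c} : Set K) :=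
      Subalgebra.add_mem _ (Algebra.self_mem_adjoin_singleton ℤ _) (Subalgebra.natCast_mem _ c)
    have h : (θ - c : K) + c = θ := by ring
    rw [h] at hmem
    exact hmem

/-- `minpoly_ℤ(θ - c) = f(X + c)`. [folklore] -/
theorem minpoly_int_θ_sub (c : ℕ) : minpoly ℤ (θ - c : K) = cubicPoly.comp (X + C (c : ℤ)) := by
  apply map_injective (algebraMap ℤ ℚ) (algebraMap ℤ ℚ).injective_int
  have h₂ : minpoly ℚ (θ - c : K) = (minpoly ℚ θ).comp (X + C (c : ℚ)) := by
    have := minpoly.sub_algebraMap (θ : K) (c : ℚ)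
    rwa [map_natCast] at this
  rw [← minpoly.isIntegrallyClosed_eq_field_fractions' ℚ (isIntegral_θ_sub c), h₂,
    minpoly.isIntegrallyClosed_eq_field_fractions' ℚ isIntegral_θ, minpoly_int_θ, Polynomial.map_comp,
    Polynomial.map_add, map_X, Polynomial.map_C]
  simp

/-- `f(X + 4) = X³ + 13X² - 390X - 5473`. [folklore] -/
theorem cubicPoly_comp_four : cubicPoly.comp (X + C ((4 : ℕ) : ℤ)) = X ^ 3 + C 13 * X ^ 2 - C 390 * X - C 5473 := by
  have h1 : (C 446 : ℤ[X]) = 446 := map_ofNat C 446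
  have h2 : (C 3769 : ℤ[X]) = 3769 := map_ofNat C 3769
  have h3 : (C 13 : ℤ[X]) = 13 := map_ofNat C 13
  have h4 : (C 390 : ℤ[X]) = 390 := map_ofNat C 390
  have h5 : (C 5473 : ℤ[X]) = 5473 := map_ofNat C 5473
  have h6 : (C ((4 : ℕ) : ℤ) : ℤ[X]) = 4 := by simp
  simp only [cubicPoly, add_comp, sub_comp, mul_comp, X_pow_comp, X_comp, C_comp]
  simp only [h1, h2, h3, h4, h5, h6]
  ring

/-- `f(X + 34) = X³ + 103X² + 3090X + 21527`. [folklore] -/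
theorem cubicPoly_comp_thirtyfour :
    cubicPoly.comp (X + C ((34 : ℕ) : ℤ)) = X ^ 3 + C 103 * X ^ 2 + C 3090 * X + C 21527 := by
  have h1 : (C 446 : ℤ[X]) = 446 := map_ofNat C 446
  have h2 : (C 3769 : ℤ[X]) = 3769 := map_ofNat C 3769
  have h3 : (C 103 : ℤ[X]) = 103 := map_ofNat C 103
  have h4 : (C 3090 : ℤ[X]) = 3090 := map_ofNat C 3090
  have h5 : (C 21527 : ℤ[X]) = 21527 := map_ofNat C 21527
  have h6 : (C ((34 : ℕ) : ℤ) : ℤ[X]) = 34 := by simp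
  simp only [cubicPoly, add_comp, sub_comp, mul_comp, X_pow_comp, X_comp, C_comp]
  simp only [h1, h2, h3, h4, h5, h6]
  ring

/-- **`f(X + 4)` is Eisenstein at `13`** (`13 ∣ 13, 390, 5473 = 13 · 421`, `13² ∤ 5473`): `13` is
totally ramified. [folklore] -/
theorem isEisensteinAt_thirteen :
    (minpoly ℤ (θ - (4 : ℕ) : K)).IsEisensteinAt (Submodule.span ℤ {(13 : ℤ)}) := by
  rw [minpoly_int_θ_sub, cubicPoly_comp_four]
  have hmonic : (X ^ 3 + C 13 * X ^ 2 - C 390 * X - C 5473 : ℤ[X]).Monic := by monicity!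
  have hdeg : (X ^ 3 + C 13 * X ^ 2 - C 390 * X - C 5473 : ℤ[X]).natDegree = 3 := by compute_degree!
  refine ⟨?_, fun {n} hn => ?_, ?_⟩
  · rw [hmonic.leadingCoeff, Ideal.mem_span_singleton]; norm_num
  · rw [hdeg] at hn
    rw [Ideal.mem_span_singleton]
    interval_cases n <;> simp [coeff_X_pow, coeff_X]
  · rw [Ideal.span_singleton_pow, Ideal.mem_span_singleton]
    simp [coeff_X_pow, coeff_X]

/-- **`f(X + 34)` is Eisenstein at `103`** (`103 ∣ 103, 3090, 21527 = 103 · 209`, `103² ∤ 21527`):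
`103` is totally ramified. [folklore] -/
theorem isEisensteinAt_hundredthree :
    (minpoly ℤ (θ - (34 : ℕ) : K)).IsEisensteinAt (Submodule.span ℤ {(103 : ℤ)}) := by
  rw [minpoly_int_θ_sub, cubicPoly_comp_thirtyfour]
  have hmonic : (X ^ 3 + C 103 * X ^ 2 + C 3090 * X + C 21527 : ℤ[X]).Monic := by monicity!
  have hdeg : (X ^ 3 + C 103 * X ^ 2 + C 3090 * X + C 21527 : ℤ[X]).natDegree = 3 := by compute_degree!
  refine ⟨?_, fun {n} hn => ?_, ?_⟩
  · rw [hmonic.leadingCoeff, Ideal.mem_span_singleton]; norm_num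
  · rw [hdeg] at hn
    rw [Ideal.mem_span_singleton]
    interval_cases n <;> simp [coeff_X_pow, coeff_X]
  · rw [Ideal.span_singleton_pow, Ideal.mem_span_singleton]
    simp [coeff_X_pow, coeff_X]

/-- **`𝓞 K = ℤ[θ]`**: every algebraic integer of `K` lies in `ℤ[θ]`. `disc(1,θ,θ²) z = 13²·103² z ∈ ℤ[θ]`
(`Algebra.discr_mul_isIntegral_mem_adjoin`); the factor `13²` is removed by Eisenstein at `13`
(generator `θ - 4`), then `103²` by Eisenstein at `103` (generator `θ - 34`)
(`mem_adjoin_of_smul_prime_pow_smul_of_minpoly_isEisensteinAt`, as for cyclotomic integers in Mathlib).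
[folklore] -/
theorem mem_adjoin_θ {z : K} (hz : IsIntegral ℤ z) : z ∈ Algebra.adjoin ℤ ({θ} : Set K) := by
  have H := Algebra.discr_mul_isIntegral_mem_adjoin ℚ isIntegral_pbθ_gen hz
  rw [discr_pbθ, pbθ_gen] at H
  have hp13 : Prime (13 : ℤ) := Int.prime_iff_natAbs_prime.mpr (by norm_num)
  have hp103 : Prime (103 : ℤ) := Int.prime_iff_natAbs_prime.mpr (by norm_num)
  -- step 1: remove `13²` from `z₁ = 103² z`
  have hz₁ : IsIntegral ℤ ((103 : ℤ) ^ 2 • z) := by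
    rw [zsmul_eq_mul]; exact (isIntegral_algebraMap (x := (103 : ℤ) ^ 2)).mul hz
  have hmem13 : (13 : ℤ) ^ 2 • ((103 : ℤ) ^ 2 • z) ∈ Algebra.adjoin ℤ ({(pbShift 4).gen} : Set K) := by
    rw [pbShift_gen, adjoin_θ_sub_eq, smul_smul]
    have h : ((13 : ℤ) ^ 2 * 103 ^ 2) • z = (1792921 : ℚ) • z := by
      rw [zsmul_eq_mul, Algebra.smul_def, map_ofNat]
      push_cast
      norm_num
    rw [h]
    exact H
  have key13 := mem_adjoin_of_smul_prime_pow_smul_of_minpoly_isEisensteinAt (K := ℚ) (B := pbShift 4)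
    hp13 (by rw [pbShift_gen]; exact isIntegral_θ_sub 4) hz₁ hmem13
    (by rw [pbShift_gen]; exact isEisensteinAt_thirteen)
  rw [pbShift_gen, adjoin_θ_sub_eq] at key13
  -- step 2: remove `103²`
  have hmem103 : (103 : ℤ) ^ 2 • z ∈ Algebra.adjoin ℤ ({(pbShift 34).gen} : Set K) := by
    rw [pbShift_gen, adjoin_θ_sub_eq]; exact key13
  have key103 := mem_adjoin_of_smul_prime_pow_smul_of_minpoly_isEisensteinAt (K := ℚ) (B := pbShift 34)
    hp103 (by rw [pbShift_gen]; exact isIntegral_θ_sub 34) hz hmem103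
    (by rw [pbShift_gen]; exact isEisensteinAt_hundredthree)
  rwa [pbShift_gen, adjoin_θ_sub_eq] at key103

/-- Elements of `ℤ[θ]` have integer coordinates on `1, θ, θ²`. [folklore] -/
theorem exists_coords_of_mem_adjoin {z : K} (hz : z ∈ Algebra.adjoin ℤ ({θ} : Set K)) :
    ∃ a b c : ℤ, z = (a : K) * θ ^ 2 + (b : K) * θ + c := by
  rw [Algebra.adjoin_singleton_eq_range_aeval] at hz
  obtain ⟨q, rfl⟩ := hz
  set r := q %ₘ cubicPoly with hr
  have hmod : aeval θ r = aeval θ q := by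
    rw [hr, Polynomial.modByMonic_eq_sub_mul_div q cubicPoly, map_sub, map_mul,
      aeval_θ_cubicPoly, zero_mul, sub_zero]
  have hne : cubicPoly ≠ 1 :=
    ne_of_apply_ne natDegree (by rw [cubicPoly_natDegree, natDegree_one]; norm_num)
  have hdeg : r.natDegree < 3 := by
    rw [hr, ← cubicPoly_natDegree]
    exact natDegree_modByMonic_lt q cubicPoly_monic hne
  have hsum : r = C (r.coeff 0) + C (r.coeff 1) * X + C (r.coeff 2) * X ^ 2 := by
    conv_lhs => rw [r.as_sum_range_C_mul_X_pow' hdeg]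
    simp [Finset.sum_range_succ]
  refine ⟨r.coeff 2, r.coeff 1, r.coeff 0, ?_⟩
  change aeval θ q = _
  rw [← hmod]
  conv_lhs => rw [hsum]
  simp only [map_add, map_mul, map_pow, aeval_X, eq_intCast, map_intCast]
  ring

/-- **Integer coordinates on `1, θ, θ²`** for algebraic integers of `K`. [folklore] -/
theorem exists_int_coords_of_isIntegral {z : K} (hz : IsIntegral ℤ z) :
    ∃ a b c : ℤ, z = (a : K) * θ ^ 2 + (b : K) * θ + c :=
  exists_coords_of_mem_adjoin (mem_adjoin_θ hz)

/-- `θ` as an element of `𝓞 K`. [folklore] -/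
def θint : 𝓞 K := ⟨θ, isIntegral_θ⟩

/-- The coercion of `θint` to `K` is `θ`. [folklore] -/
@[simp] theorem coe_θint : ((θint : 𝓞 K) : K) = θ := rfl

/-- **Integer coordinates on `1, θ, θ²`** for elements of `𝓞 K`. [folklore] -/
theorem exists_int_coords (z : 𝓞 K) : ∃ a b c : ℤ, z = a * θint ^ 2 + b * θint + c := by
  obtain ⟨a, b, c, h⟩ := exists_int_coords_of_isIntegral z.2
  refine ⟨a, b, c, RingOfIntegers.coe_injective ?_⟩
  simp only [map_add, map_mul, map_pow, map_intCast, coe_θint]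
  exact h

/-- `ℤ[θ] = 𝓞 K`, as subalgebras of `𝓞 K`. [folklore] -/
theorem adjoin_θint_eq_top : Algebra.adjoin ℤ ({θint} : Set (𝓞 K)) = ⊤ := by
  refine Algebra.eq_top_iff.2 fun z => ?_
  obtain ⟨a, b, c, rfl⟩ := exists_int_coords z
  have hθ := Algebra.self_mem_adjoin_singleton ℤ (θint : 𝓞 K)
  refine Subalgebra.add_mem _ (Subalgebra.add_mem _ (Subalgebra.mul_mem _ (Subalgebra.intCast_mem _ _)
    (Subalgebra.pow_mem _ hθ 2)) (Subalgebra.mul_mem _ (Subalgebra.intCast_mem _ _) hθ))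
    (Subalgebra.intCast_mem _ _)

/-- The Dedekind–Kummer exponent of `θ` is `1` (trivial conductor). [folklore] -/
theorem exponent_θint : RingOfIntegers.exponent θint = 1 :=
  RingOfIntegers.exponent_eq_one_iff.mpr adjoin_θint_eq_top

/-- `minpoly_ℤ θint = f`. [folklore] -/
theorem minpoly_θint : minpoly ℤ θint = cubicPoly := by
  rw [← RingOfIntegers.minpoly_coe, coe_θint]
  convert minpoly_int_θ
  exact Subsingleton.elim _ _

/-- The cubic relation in `𝓞 K`: `θ³ + θ² - 446θ - 3769 = 0`. [folklore] -/
theorem θint_rel : (θint : 𝓞 K) ^ 3 + θint ^ 2 - 446 * θint - 3769 = 0 := by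
  apply RingOfIntegers.coe_injective
  simp only [map_add, map_sub, map_mul, map_pow, map_zero, coe_θint, map_ofNat]
  rw [θ_pow_three]
  ring

/-! ### The units `u₁ = θ + 12` and `u₂ = -(θ + 13)` -/

/-- **The unit `u₁ = θ + 12`** of `𝓞 K` (`N = 1`), with inverse `θ² - 11θ - 314`
(`f = (X + 12)(X² - 11X - 314) - 1`). [folklore] -/
def unit₁ : (𝓞 K)ˣ :=
  Units.mkOfMulEqOne (θint + 12) (θint ^ 2 - 11 * θint - 314) (by linear_combination θint_rel)

/-- **The unit `u₂ = -(θ + 13)`** of `𝓞 K` (`N = 1`), with inverse `θ² - 12θ - 290`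
(`f = (X + 13)(X² - 12X - 290) + 1`). [folklore] -/
def unit₂ : (𝓞 K)ˣ :=
  Units.mkOfMulEqOne (-θint - 13) (θint ^ 2 - 12 * θint - 290) (by linear_combination (-(1 : 𝓞 K)) * θint_rel)

/-- The underlying element of `unit₁`. [folklore] -/
@[simp] theorem coe_unit₁ : ((unit₁ : (𝓞 K)ˣ) : 𝓞 K) = θint + 12 := rfl

/-- The underlying element of `unit₂`. [folklore] -/
@[simp] theorem coe_unit₂ : ((unit₂ : (𝓞 K)ˣ) : 𝓞 K) = -θint - 13 := rfl

/-- `N(θ + 12) = 1`. [folklore] -/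
theorem norm_u₁ : Algebra.norm ℚ (θ + 12 : K) = 1 := by
  have h := norm_quadratic 0 1 12
  push_cast at h
  rw [show (0 : K) * θ ^ 2 + 1 * θ + 12 = θ + 12 by ring] at h
  rw [h]; norm_num

/-- `N(-(θ + 13)) = 1`. [folklore] -/
theorem norm_u₂ : Algebra.norm ℚ (-θ - 13 : K) = 1 := by
  have h := norm_quadratic 0 (-1) (-13)
  push_cast at h
  rw [show (0 : K) * θ ^ 2 + -1 * θ + -13 = -θ - 13 by ring] at h
  rw [h]; norm_num

/-! ### The automorphism `σ : θ ↦ θ² - 12θ - 302` of order `3`; `K/ℚ` is Galois -/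

/-- `s(θ) = θ² - 12θ - 302` is again a root of `f`. [folklore] -/
theorem aeval_σθ : aeval (θ ^ 2 - 12 * θ - 302 : K) cubicPolyRat = 0 := by
  refine (aeval_map_algebraMap ℚ _ cubicPoly).trans ?_
  rw [cubicPoly, map_sub, map_sub, map_add, map_pow, map_pow, map_mul, aeval_C, aeval_X, aeval_C,
    map_ofNat, map_ofNat]
  ring_nf
  rw [θ_pow_six, θ_pow_five, θ_pow_four, θ_pow_three]
  ring

/-- The `ℚ`-algebra endomorphism of `K` sending `θ ↦ θ² - 12θ - 302`. [folklore] -/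
def σHom : K →ₐ[ℚ] K :=
  AdjoinRoot.liftAlgHom cubicPolyRat (Algebra.ofId ℚ K) (θ ^ 2 - 12 * θ - 302) aeval_σθ

/-- `σHom θ = θ² - 12θ - 302`. [folklore] -/
theorem σHom_θ : σHom θ = θ ^ 2 - 12 * θ - 302 := AdjoinRoot.liftAlgHom_root _ _ _ _

/-- **The automorphism `σ` of `K/ℚ`**, `σ(θ) = θ² - 12θ - 302`. [folklore] -/
def σ : K ≃ₐ[ℚ] K :=
  AlgEquiv.ofBijective σHom ⟨(σHom : K →+* K).injective,
    LinearMap.surjective_of_injective (f := σHom.toLinearMap) (σHom : K →+* K).injective⟩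

/-- `σ θ = θ² - 12θ - 302`. [folklore] -/
theorem σ_θ : σ θ = θ ^ 2 - 12 * θ - 302 := σHom_θ

/-- `σ² θ = -θ² + 11θ + 301` (the third root). [folklore] -/
theorem σ_σ_θ : σ (σ θ) = -θ ^ 2 + 11 * θ + 301 := by
  rw [σ_θ, map_sub, map_sub, map_mul, map_pow, σ_θ, map_ofNat, map_ofNat]
  ring_nf
  rw [θ_pow_four, θ_pow_three]
  ring

/-- `σ³ = 1`: `σ(-θ² + 11θ + 301) = θ`. [folklore] -/
theorem σ_σ_σ_θ : σ (σ (σ θ)) = θ := by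
  rw [σ_σ_θ, map_add, map_add, map_neg, map_mul, map_pow, σ_θ, map_ofNat, map_ofNat]
  ring_nf
  rw [θ_pow_four, θ_pow_three]
  ring

/-- A `ℚ`-algebra endomorphism of `K = ℚ(θ)` is determined by the image of `θ`. [folklore] -/
theorem algEquiv_eq_of_apply_θ {g h : K ≃ₐ[ℚ] K} (hgh : g θ = h θ) : g = h := by
  apply AlgEquiv.coe_toAlgHom_injective
  refine AdjoinRoot.algHom_ext ?_
  change g θ = h θ
  exact hgh

/-- `σ³ = 1` in `Gal(K/ℚ)`. [folklore] -/
theorem σ_pow_three : σ ^ 3 = 1 :=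
  algEquiv_eq_of_apply_θ (by rw [pow_three, AlgEquiv.mul_apply, AlgEquiv.mul_apply, σ_σ_σ_θ]; rfl)

/-- `σ ≠ 1` (`σ θ = θ` would mean `θ² - 13θ - 302 = 0`). [folklore] -/
theorem σ_ne_one : σ ≠ 1 := by
  intro h
  have e : σ θ = θ := by rw [h]; rfl
  rw [σ_θ] at e
  have : ((1 : ℚ) : K) * θ ^ 2 + ((-13 : ℚ) : K) * θ + ((-302 : ℚ) : K) = 0 := by
    push_cast; linear_combination e
  exact quadratic_ne_zero (by norm_num) this

/-- `σ² ≠ 1` (`σ² θ = θ` would mean `-θ² + 10θ + 301 = 0`). [folklore] -/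
theorem σ_sq_ne_one : σ ^ 2 ≠ 1 := by
  intro h
  have e : σ (σ θ) = θ := by rw [← AlgEquiv.mul_apply, ← pow_two, h]; rfl
  rw [σ_σ_θ] at e
  have : ((-1 : ℚ) : K) * θ ^ 2 + ((10 : ℚ) : K) * θ + ((301 : ℚ) : K) = 0 := by
    push_cast; linear_combination e
  exact quadratic_ne_zero (by norm_num) this

/-- `σ² ≠ σ`. [folklore] -/
theorem σ_sq_ne_σ : σ ^ 2 ≠ σ := fun h => σ_ne_one (by
  have := congrArg (· * σ⁻¹) h
  simpa [pow_two, mul_assoc] using this)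

/-- **`|Gal(K/ℚ)| = 3`**: `1, σ, σ²` are distinct and `|Aut_ℚ(K)| ≤ [K : ℚ] = 3`. [folklore] -/
theorem card_gal : Nat.card (K ≃ₐ[ℚ] K) = 3 := by
  classical
  rw [Nat.card_eq_fintype_card]
  refine le_antisymm (finrank_K ▸ AlgEquiv.card_le) ?_
  have h3 : ({1, σ, σ ^ 2} : Finset (K ≃ₐ[ℚ] K)).card = 3 := by
    rw [Finset.card_insert_of_notMem, Finset.card_insert_of_notMem, Finset.card_singleton]
    · rw [Finset.mem_singleton]; exact σ_sq_ne_σ.symm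
    · rw [Finset.mem_insert, Finset.mem_singleton, not_or]
      exact ⟨σ_ne_one.symm, σ_sq_ne_one.symm⟩
  rw [← h3]
  exact Finset.card_le_univ _

/-- **`K/ℚ` is Galois** (cyclic of degree `3`). [folklore] -/
instance isGalois : IsGalois ℚ K := IsGalois.of_card_aut_eq_finrank ℚ K (card_gal.trans finrank_K.symm)

/-- Every element of `Gal(K/ℚ)` is `1`, `σ` or `σ²`. [folklore] -/
theorem gal_cases (g : K ≃ₐ[ℚ] K) : g = 1 ∨ g = σ ∨ g = σ ^ 2 := by
  classical
  by_contra h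
  simp only [not_or] at h
  have h4 : ({1, σ, σ ^ 2, g} : Finset (K ≃ₐ[ℚ] K)).card = 4 := by
    rw [Finset.card_insert_of_notMem, Finset.card_insert_of_notMem, Finset.card_insert_of_notMem,
      Finset.card_singleton]
    · rw [Finset.mem_singleton]; exact fun e => h.2.2 e.symm
    · rw [Finset.mem_insert, Finset.mem_singleton, not_or]
      exact ⟨σ_sq_ne_σ.symm, fun e => h.2.1 e.symm⟩
    · rw [Finset.mem_insert, Finset.mem_insert, Finset.mem_singleton, not_or, not_or]
      exact ⟨σ_ne_one.symm, σ_sq_ne_one.symm, fun e => h.1 e.symm⟩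
  have hle : ({1, σ, σ ^ 2, g} : Finset (K ≃ₐ[ℚ] K)).card ≤ Fintype.card (K ≃ₐ[ℚ] K) :=
    Finset.card_le_univ _
  rw [h4, ← Nat.card_eq_fintype_card, card_gal] at hle
  omega

/-- **`N_{K/ℚ}(x) = x · σx · σ²x`** for every `x ∈ K`. [folklore] -/
theorem norm_eq_mul_σ_mul_σσ (x : K) : algebraMap ℚ K (Algebra.norm ℚ x) = x * σ x * σ (σ x) := by
  classical
  rw [Algebra.norm_eq_prod_automorphisms]
  have huniv : (Finset.univ : Finset (K ≃ₐ[ℚ] K)) = {1, σ, σ ^ 2} := by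
    ext g
    simp only [Finset.mem_univ, Finset.mem_insert, Finset.mem_singleton, true_iff]
    exact gal_cases g
  rw [huniv, Finset.prod_insert, Finset.prod_insert, Finset.prod_singleton]
  · rw [pow_two, AlgEquiv.mul_apply, AlgEquiv.one_apply, mul_assoc]
  · rw [Finset.mem_singleton]; exact σ_sq_ne_σ.symm
  · rw [Finset.mem_insert, Finset.mem_singleton, not_or]; exact ⟨σ_ne_one.symm, σ_sq_ne_one.symm⟩

/-! ### The three real embeddings and the signs of `u₁`, `u₂` -/

/-- The real cubic function `p(x) = x³ + x² - 446x - 3769`. [folklore] -/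
def preal (x : ℝ) : ℝ := x ^ 3 + x ^ 2 - 446 * x - 3769

/-- `p` is continuous. [folklore] -/
theorem continuous_preal : Continuous preal := by unfold preal; fun_prop

/-- `f` has a real root in each of `(-14, -13)`, `(-13, -12)`, `(24, 25)` (sign changes
`p(-14) = -73 < 0 < 1 = p(-13)`, `p(-13) = 1 > 0 > -1 = p(-12)`, `p(24) = -73 < 0 < 1331 = p(25)`).
[folklore] -/
theorem exists_roots_preal :
    (∃ r, r ∈ Set.Ioo (-14 : ℝ) (-13) ∧ preal r = 0) ∧ (∃ r, r ∈ Set.Ioo (-13 : ℝ) (-12) ∧ preal r = 0) ∧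
      (∃ r, r ∈ Set.Ioo (24 : ℝ) 25 ∧ preal r = 0) := by
  refine ⟨?_, ?_, ?_⟩
  · have h := intermediate_value_Ioo (show (-14 : ℝ) ≤ -13 by norm_num) continuous_preal.continuousOn
    have h0 : (0 : ℝ) ∈ Set.Ioo (preal (-14)) (preal (-13)) := by simp only [preal, Set.mem_Ioo]; norm_num
    obtain ⟨r, hr, hr0⟩ := h h0
    exact ⟨r, hr, hr0⟩
  · have h := intermediate_value_Ioo' (show (-13 : ℝ) ≤ -12 by norm_num) continuous_preal.continuousOn
    have h0 : (0 : ℝ) ∈ Set.Ioo (preal (-12)) (preal (-13)) := by simp only [preal, Set.mem_Ioo]; norm_num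
    obtain ⟨r, hr, hr0⟩ := h h0
    exact ⟨r, hr, hr0⟩
  · have h := intermediate_value_Ioo (show (24 : ℝ) ≤ 25 by norm_num) continuous_preal.continuousOn
    have h0 : (0 : ℝ) ∈ Set.Ioo (preal 24) (preal 25) := by simp only [preal, Set.mem_Ioo]; norm_num
    obtain ⟨r, hr, hr0⟩ := h h0
    exact ⟨r, hr, hr0⟩

/-- The real root `r₁ ∈ (-14, -13)` of `f` (`≈ -13.028`). [folklore] -/
def r₁ : ℝ := Classical.choose exists_roots_preal.1
/-- The real root `r₂ ∈ (-13, -12)` of `f` (`≈ -12.027`). [folklore] -/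
def r₂ : ℝ := Classical.choose exists_roots_preal.2.1
/-- The real root `r₃ ∈ (24, 25)` of `f` (`≈ 24.055`). [folklore] -/
def r₃ : ℝ := Classical.choose exists_roots_preal.2.2

/-- `-14 < r₁ < -13` and `p(r₁) = 0`. [folklore] -/
theorem r₁_spec : r₁ ∈ Set.Ioo (-14 : ℝ) (-13) ∧ preal r₁ = 0 := Classical.choose_spec exists_roots_preal.1
/-- `-13 < r₂ < -12` and `p(r₂) = 0`. [folklore] -/
theorem r₂_spec : r₂ ∈ Set.Ioo (-13 : ℝ) (-12) ∧ preal r₂ = 0 := Classical.choose_spec exists_roots_preal.2.1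
/-- `24 < r₃ < 25` and `p(r₃) = 0`. [folklore] -/
theorem r₃_spec : r₃ ∈ Set.Ioo (24 : ℝ) 25 ∧ preal r₃ = 0 := Classical.choose_spec exists_roots_preal.2.2

/-- A real root of `p` is a root of `cubicPolyRat` under `ℚ → ℝ`. [folklore] -/
theorem eval₂_cubicPolyRat_real {r : ℝ} (hr : preal r = 0) :
    cubicPolyRat.eval₂ (algebraMap ℚ ℝ) r = 0 := by
  rw [eval₂_map, cubicPoly, eval₂_sub, eval₂_sub, eval₂_add, eval₂_X_pow, eval₂_X_pow, eval₂_mul,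
    eval₂_C, eval₂_X, eval₂_C, map_ofNat, map_ofNat]
  exact hr

/-- **The real embedding `e₁ : K → ℝ`, `θ ↦ r₁`.** [folklore] -/
def e₁ : K →+* ℝ := AdjoinRoot.lift (algebraMap ℚ ℝ) r₁ (eval₂_cubicPolyRat_real r₁_spec.2)
/-- **The real embedding `e₂ : K → ℝ`, `θ ↦ r₂`.** [folklore] -/
def e₂ : K →+* ℝ := AdjoinRoot.lift (algebraMap ℚ ℝ) r₂ (eval₂_cubicPolyRat_real r₂_spec.2)
/-- **The real embedding `e₃ : K → ℝ`, `θ ↦ r₃`.** [folklore] -/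
def e₃ : K →+* ℝ := AdjoinRoot.lift (algebraMap ℚ ℝ) r₃ (eval₂_cubicPolyRat_real r₃_spec.2)

/-- `e₁ θ = r₁`. [folklore] -/
@[simp] theorem e₁_θ : e₁ θ = r₁ := AdjoinRoot.lift_root _
/-- `e₂ θ = r₂`. [folklore] -/
@[simp] theorem e₂_θ : e₂ θ = r₂ := AdjoinRoot.lift_root _
/-- `e₃ θ = r₃`. [folklore] -/
@[simp] theorem e₃_θ : e₃ θ = r₃ := AdjoinRoot.lift_root _

/-- The three real embeddings are pairwise distinct (they separate `θ`). [folklore] -/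
theorem e_ne : e₁ ≠ e₂ ∧ e₁ ≠ e₃ ∧ e₂ ≠ e₃ := by
  have h1 := r₁_spec.1; have h2 := r₂_spec.1; have h3 := r₃_spec.1
  simp only [Set.mem_Ioo] at h1 h2 h3
  refine ⟨fun h => ?_, fun h => ?_, fun h => ?_⟩
  · have := congrArg (· θ) h; simp only [e₁_θ, e₂_θ] at this; linarith
  · have := congrArg (· θ) h; simp only [e₁_θ, e₃_θ] at this; linarith
  · have := congrArg (· θ) h; simp only [e₂_θ, e₃_θ] at this; linarith

/-! ### Units modulo squares: `(𝓞 K)ˣ/(𝓞 K)ˣ² = {±u₁^i u₂^j}` via real signs -/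

/-- For a cubic field the unit rank is at most `2`. [folklore] -/
theorem units_rank_le_two : Units.rank K ≤ 2 := by
  have h1 := InfinitePlace.card_add_two_mul_card_eq_rank K
  have h2 := InfinitePlace.card_eq_nrRealPlaces_add_nrComplexPlaces K
  rw [finrank_K] at h1
  rw [Units.rank, h2]
  omega

/-- **Units modulo squares (Dirichlet)**, as in `CyclicCubic13.exists_rep_mul_sq`. [folklore] -/
theorem exists_rep_mul_sq (x : (𝓞 K)ˣ) :
    ∃ (s : Fin 2) (ε : Fin (Units.rank K) → Fin 2) (η : (𝓞 K)ˣ),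
      x = ((-1) ^ (s : ℕ) * ∏ i, Units.fundSystem K i ^ ((ε i : ℕ))) * η ^ 2 := by
  classical
  obtain ⟨⟨ζ, e⟩, hx, -⟩ := Units.exist_unique_eq_mul_prod K x
  have hodd : Odd (Module.finrank ℚ K) := by rw [finrank_K]; decide
  refine ⟨if ((ζ : (𝓞 K)ˣ) = 1) then 0 else 1, fun i => ⟨(e i % 2).toNat, by omega⟩,
    ∏ i, Units.fundSystem K i ^ (e i / 2), ?_⟩
  have hsplit : ∀ i, Units.fundSystem K i ^ e i =
      Units.fundSystem K i ^ (((⟨(e i % 2).toNat, by omega⟩ : Fin 2) : ℕ)) *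
        (Units.fundSystem K i ^ (e i / 2)) ^ 2 := by
    intro i
    rw [← zpow_natCast, ← zpow_natCast (Units.fundSystem K i ^ (e i / 2)) 2, ← zpow_mul,
      ← zpow_add]
    congr 1
    push_cast
    rw [Int.toNat_of_nonneg (Int.emod_nonneg _ two_ne_zero)]
    omega
  rw [← Finset.prod_pow, mul_assoc, ← Finset.prod_mul_distrib]
  simp_rw [← hsplit]
  rcases Units.torsion_eq_one_or_neg_one_of_odd_finrank hodd ζ with hζ | hζ
  · rw [if_pos hζ]
    simp only [Fin.val_zero, pow_zero, one_mul]
    rw [hζ, one_mul] at hx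
    exact hx
  · have hne : (ζ : (𝓞 K)ˣ) ≠ 1 := by
      rw [hζ]
      intro h
      have h' := congrArg (fun u : (𝓞 K)ˣ => (u : 𝓞 K)) h
      simp only [Units.val_neg, Units.val_one] at h'
      norm_num at h'
    rw [if_neg hne]
    simp only [Fin.val_one, pow_one]
    rw [hζ] at hx
    exact hx

/-- The **sign vector** of a unit under the three real embeddings. [folklore] -/
def sgn (y : (𝓞 K)ˣ) : SignType × SignType × SignType :=
  (SignType.sign (e₁ ((y : 𝓞 K) : K)), SignType.sign (e₂ ((y : 𝓞 K) : K)),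
    SignType.sign (e₃ ((y : 𝓞 K) : K)))

/-- The sign vector is multiplicative. [folklore] -/
theorem sgn_mul (y z : (𝓞 K)ˣ) : sgn (y * z) = sgn y * sgn z := by
  simp only [sgn, Units.val_mul, map_mul, sign_mul, Prod.mk_mul_mk]

/-- A real embedding does not vanish on units. [folklore] -/
theorem emb_units_ne_zero (e : K →+* ℝ) (y : (𝓞 K)ˣ) : e ((y : 𝓞 K) : K) ≠ 0 :=
  (map_ne_zero e).mpr (RingOfIntegers.coe_ne_zero_iff.mpr (Units.ne_zero y))

/-- Squares of units are totally positive: `sgn (η²) = 1`. [folklore] -/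
theorem sgn_sq (η : (𝓞 K)ˣ) : sgn (η ^ 2) = 1 := by
  have h : ∀ e : K →+* ℝ, SignType.sign (e (((η ^ 2 : (𝓞 K)ˣ) : 𝓞 K) : K)) = 1 := fun e => by
    have hc : (((η ^ 2 : (𝓞 K)ˣ) : 𝓞 K) : K) = (((η : (𝓞 K)ˣ) : 𝓞 K) : K) ^ 2 := by
      rw [Units.val_pow_eq_pow_val]; push_cast; rfl
    rw [hc, map_pow]
    exact sign_pos (lt_of_le_of_ne (sq_nonneg _) (Ne.symm (pow_ne_zero 2 (emb_units_ne_zero e η))))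
  simp only [sgn, h]
  rfl

/-- `sgn(-1) = (-, -, -)`. [folklore] -/
theorem sgn_neg_one : sgn (-1) = (-1, -1, -1) := by
  have h : ∀ e : K →+* ℝ, SignType.sign (e (((-1 : (𝓞 K)ˣ) : 𝓞 K) : K)) = -1 := fun e => by
    rw [Units.val_neg, Units.val_one]
    push_cast
    rw [map_neg, map_one]
    exact sign_neg (by norm_num)
  simp only [sgn, h]

/-- `sgn(u₁) = (-, -, +)`: `θ + 12` at `r₁ < -13`, `r₂ < -12`, `r₃ > 24`. [folklore] -/
theorem sgn_unit₁ : sgn unit₁ = (-1, -1, 1) := by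
  have h1 := r₁_spec.1; have h2 := r₂_spec.1; have h3 := r₃_spec.1
  simp only [Set.mem_Ioo] at h1 h2 h3
  simp only [sgn, coe_unit₁, map_add, map_ofNat, coe_θint, e₁_θ, e₂_θ, e₃_θ]
  rw [sign_neg (by linarith), sign_neg (by linarith), sign_pos (by linarith)]

/-- `sgn(u₂) = (+, -, -)`: `-(θ + 13)` at `r₁ < -13 < r₂, r₃`. [folklore] -/
theorem sgn_unit₂ : sgn unit₂ = (1, -1, -1) := by
  have h1 := r₁_spec.1; have h2 := r₂_spec.1; have h3 := r₃_spec.1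
  simp only [Set.mem_Ioo] at h1 h2 h3
  simp only [sgn, coe_unit₂, map_sub, map_neg, map_ofNat, coe_θint, e₁_θ, e₂_θ, e₃_θ]
  rw [sign_pos (by linarith), sign_neg (by linarith), sign_neg (by linarith)]

/-- The eight representatives `±u₁^i u₂^j`, `i, j ∈ {0, 1}`. [folklore] -/
def rep (a i j : Fin 2) : (𝓞 K)ˣ := (-1) ^ (a : ℕ) * unit₁ ^ (i : ℕ) * unit₂ ^ (j : ℕ)

/-- The sign vectors of the eight representatives run through `{±1}³`. [folklore] -/
theorem sgn_rep (a i j : Fin 2) :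
    sgn (rep a i j) = ((-1) ^ (a : ℕ) * (-1) ^ (i : ℕ), (-1) ^ (a : ℕ) * (-1) ^ (i : ℕ) * (-1) ^ (j : ℕ),
      (-1) ^ (a : ℕ) * (-1) ^ (j : ℕ)) := by
  have hpow : ∀ (u : (𝓞 K)ˣ) (k : Fin 2), sgn (u ^ (k : ℕ)) = sgn u ^ (k : ℕ) := by
    intro u k
    fin_cases k
    · simp [sgn]
    · simp
  rw [rep, sgn_mul, sgn_mul, hpow, hpow, hpow, sgn_neg_one, sgn_unit₁, sgn_unit₂]
  fin_cases a <;> fin_cases i <;> fin_cases j <;> decide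

/-- **A unit of trivial sign vector (totally positive) is a square** (the eight `±u₁^i u₂^j`
realise all sign vectors and there are at most `8` classes modulo squares, so `sgn` is injective
modulo squares). [folklore] -/
theorem exists_sq_eq_of_sgn_eq_one (x : (𝓞 K)ˣ) (hx : sgn x = 1) : ∃ η : (𝓞 K)ˣ, x = η ^ 2 := by
  classical
  set F := Units.fundSystem K with hF
  let E := Fin 2 × (Fin (Units.rank K) → Fin 2)
  let ρ : E → (𝓞 K)ˣ := fun e => (-1) ^ (e.1 : ℕ) * ∏ i, F i ^ ((e.2 i : ℕ))
  have hρ0 : ρ (0, fun _ => 0) = 1 := by simp [ρ]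
  have hcardE : Fintype.card E ≤ 8 := by
    have hr := units_rank_le_two
    simp only [E, Fintype.card_prod, Fintype.card_fun, Fintype.card_fin]
    calc 2 * 2 ^ Units.rank K ≤ 2 * 2 ^ 2 :=
          Nat.mul_le_mul_left 2 (Nat.pow_le_pow_right (by norm_num) hr)
      _ = 8 := by norm_num
  let T : Finset (SignType × SignType × SignType) :=
    {(1, 1, 1), (1, 1, -1), (1, -1, 1), (1, -1, -1), (-1, 1, 1), (-1, 1, -1), (-1, -1, 1),
      (-1, -1, -1)}
  have hTcard : T.card = 8 := by decide
  have hred : ∀ y : (𝓞 K)ˣ, ∃ e : E, sgn y = sgn (ρ e) := by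
    intro y
    obtain ⟨s, ε, η, hy⟩ := exists_rep_mul_sq y
    exact ⟨(s, ε), by rw [hy, sgn_mul, sgn_sq, mul_one]⟩
  have hsurjT : T ⊆ Finset.univ.image (sgn ∘ ρ) := by
    intro v hv
    rw [Finset.mem_image]
    have hreal : ∃ y : (𝓞 K)ˣ, sgn y = v := by
      simp only [T, Finset.mem_insert, Finset.mem_singleton] at hv
      rcases hv with rfl | rfl | rfl | rfl | rfl | rfl | rfl | rfl
      · exact ⟨rep 0 0 0, by rw [sgn_rep]; decide⟩
      · exact ⟨rep 1 1 0, by rw [sgn_rep]; decide⟩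
      · exact ⟨rep 1 1 1, by rw [sgn_rep]; decide⟩
      · exact ⟨rep 0 0 1, by rw [sgn_rep]; decide⟩
      · exact ⟨rep 1 0 1, by rw [sgn_rep]; decide⟩
      · exact ⟨rep 0 1 1, by rw [sgn_rep]; decide⟩
      · exact ⟨rep 0 1 0, by rw [sgn_rep]; decide⟩
      · exact ⟨rep 1 0 0, by rw [sgn_rep]; decide⟩
    obtain ⟨y, hy⟩ := hreal
    obtain ⟨e, he⟩ := hred y
    exact ⟨e, Finset.mem_univ e, by rw [Function.comp_apply, ← he, hy]⟩
  have hinj : Set.InjOn (sgn ∘ ρ) (Finset.univ : Finset E) := by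
    rw [← Finset.card_image_iff]
    apply le_antisymm Finset.card_image_le
    calc (Finset.univ : Finset E).card = Fintype.card E := Finset.card_univ
      _ ≤ 8 := hcardE
      _ = T.card := hTcard.symm
      _ ≤ (Finset.univ.image (sgn ∘ ρ)).card := Finset.card_le_card hsurjT
  obtain ⟨s, ε, η, hxe⟩ := exists_rep_mul_sq x
  have hρe : sgn (ρ (s, ε)) = sgn (ρ (0, fun _ => 0)) := by
    rw [hρ0]
    have : sgn x = sgn (ρ (s, ε)) := by rw [hxe, sgn_mul, sgn_sq, mul_one]
    rw [← this, hx]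
    simp only [sgn, Units.val_one, map_one, sign_one]
    rfl
  have he0 : (s, ε) = (0, fun _ => 0) := hinj (Finset.mem_univ _) (Finset.mem_univ _) hρe
  refine ⟨η, ?_⟩
  rw [hxe, show ((-1) ^ (s : ℕ) * ∏ i, F i ^ ((ε i : ℕ)) : (𝓞 K)ˣ) = ρ (s, ε) from rfl, he0, hρ0,
    one_mul]

/-- Each coordinate of a sign vector of a unit is `±1`. [folklore] -/
theorem sgn_coord_cases (x : (𝓞 K)ˣ) (e : K →+* ℝ) :
    SignType.sign (e ((x : 𝓞 K) : K)) = 1 ∨ SignType.sign (e ((x : 𝓞 K) : K)) = -1 := by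
  rcases lt_or_gt_of_ne (emb_units_ne_zero e x) with h | h
  · exact Or.inr (sign_neg h)
  · exact Or.inl (sign_pos h)

/-- Group-theoretic bookkeeping: `x R = η²` gives `x = R (η R⁻¹)²`. [folklore] -/
theorem eq_mul_sq_of_mul_eq_sq {G : Type*} [CommGroup G] {x R η : G} (h : x * R = η ^ 2) :
    x = R * (η * R⁻¹) ^ 2 := by
  rw [mul_pow, inv_pow, ← h, ← mul_assoc, mul_comm R (x * R), mul_assoc x R R, ← pow_two,
    mul_inv_cancel_right]

/-- **Every unit of `K` is `±u₁^i u₂^j` times a square** (`i, j ∈ {0, 1}`). [folklore] -/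
theorem exists_eq_rep_mul_sq (x : (𝓞 K)ˣ) : ∃ (a i j : Fin 2) (η : (𝓞 K)ˣ), x = rep a i j * η ^ 2 := by
  obtain ⟨v, hv⟩ : ∃ v, sgn x = v := ⟨_, rfl⟩
  have hv1 : v.1 = 1 ∨ v.1 = -1 := by rw [← hv]; exact sgn_coord_cases x e₁
  have hv2 : v.2.1 = 1 ∨ v.2.1 = -1 := by rw [← hv]; exact sgn_coord_cases x e₂
  have hv3 : v.2.2 = 1 ∨ v.2.2 = -1 := by rw [← hv]; exact sgn_coord_cases x e₃
  obtain ⟨v₁, v₂, v₃⟩ := v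
  simp only at hv1 hv2 hv3
  have hR : ∃ a i j : Fin 2, sgn (rep a i j) = (v₁, v₂, v₃) ∧ sgn (x * rep a i j) = 1 := by
    simp_rw [sgn_mul, hv]
    rcases hv1 with rfl | rfl <;> rcases hv2 with rfl | rfl <;> rcases hv3 with rfl | rfl <;>
      first
      | exact ⟨0, 0, 0, by rw [sgn_rep]; decide⟩ | exact ⟨1, 1, 0, by rw [sgn_rep]; decide⟩
      | exact ⟨1, 0, 1, by rw [sgn_rep]; decide⟩ | exact ⟨0, 1, 1, by rw [sgn_rep]; decide⟩
      | exact ⟨1, 1, 1, by rw [sgn_rep]; decide⟩ | exact ⟨0, 0, 1, by rw [sgn_rep]; decide⟩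
      | exact ⟨0, 1, 0, by rw [sgn_rep]; decide⟩ | exact ⟨1, 0, 0, by rw [sgn_rep]; decide⟩
  obtain ⟨a, i, j, -, hsq⟩ := hR
  obtain ⟨η, hη⟩ := exists_sq_eq_of_sgn_eq_one _ hsq
  exact ⟨a, i, j, η * (rep a i j)⁻¹, eq_mul_sq_of_mul_eq_sq hη⟩

/-- **A totally positive unit of `K` is a square.** [folklore] -/
theorem exists_sq_eq_of_pos (x : (𝓞 K)ˣ) (h₁ : 0 < e₁ ((x : 𝓞 K) : K)) (h₂ : 0 < e₂ ((x : 𝓞 K) : K))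
    (h₃ : 0 < e₃ ((x : 𝓞 K) : K)) : ∃ η : (𝓞 K)ˣ, x = η ^ 2 :=
  exists_sq_eq_of_sgn_eq_one x (by simp only [sgn, sign_pos h₁, sign_pos h₂, sign_pos h₃]; rfl)

end CyclicCubic1339B

end Literature.NumberTheory.NumberFields

end
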